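import Literature.NumberTheory.LFunctions.LFDSingleDetect
import Literature.NumberTheory.LFunctions.ZetaFractionalPartIntegral
import Mathlib.NumberTheory.Harmonic.ZetaAsymp
import HarnessLib

/-!
# Log-free zero density for one character, II: the Gram entries

Topic `Literature/NumberTheory/LFunctions`, sub-namespace `LFDSingle`. Everything here is PROVED.
For the duality step of the Graham–Heath-Brown zero-density argument for ONE primitive character
`χ mod q` (PLMS 64 (1992), §11, (11.11), (11.15)–(11.17)) one needs the "Gram entries"

  `G(κ) = Σ_n (θ∗1)(n)² 𝟙_{(n,q)=1} n^{-κ} (e^{-n/X} − e^{-n/Y})`,  `κ = ρ + ρ̄' − 1`,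

for pairs of zeros `ρ, ρ'` (in Heath-Brown's setting `χ ≠ χ'` and the entries are small; for a
single character the same `χ` occurs twice, `|χ(n)|² = χ₀(n)`, and the Dirichlet series
`Σ (θ∗1)² χ₀ n^{-s} = L(s, χ₀) D_q(s)` has the pole of `L(s, χ₀)` at `s = 1`). Writing the two
exponential cutoffs as Cahen–Mellin integrals (the difference `X^w − Y^w` kills the pole of `Γ`
at `w = 0`) and moving the line to `re w = −1/4` across the simple pole at `w₁ = 1 − κ` gives the
exact formula (`gramSum_eq`)

  `G(κ) = (φ(q)/q) D_q(1) (X^{w₁} − Y^{w₁}) Γ(w₁) + (1/2π) ∫ H(−1/4 + iy) dy`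

and the bound (`norm_gramSum_le`) `|G(κ)| ≤ (φ(q)/q) D_q(1) ‖(X^{w₁} − Y^{w₁}) Γ(w₁)‖ + 512 K₂`,
`K₂ = (4096π²/3) τ(q) (1 + ‖κ‖) ⌊W⌋² Y^{-1/4}`, together with the two estimates for the
Gamma factor (`norm_cpow_sub_cpow_mul_Gamma_le_log`, `…_le_inv`):
`‖(X^{w₁} − Y^{w₁})Γ(w₁)‖ ≤ 16π² X^{re w₁}(1+|τ|)^{3/2}e^{-π|τ|/2} · min(log(X/Y), 2/|τ|)`, `τ = im w₁`.
Here `D_q = Fpoly 1 1 W W` of part I with the trivial character (the coprimality rides on `χ₀`).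

## References
* D. R. Heath-Brown, PLMS 64 (1992), §11, (11.11)–(11.17). [cite: HeathBrown1992PLMS, §11]
-/

noncomputable section

open Finset Real Complex MeasureTheory ArithmeticFunction
open Literature.NumberTheory.Sieve Literature.NumberTheory.Sieve.GrahamWeights

open scoped ArithmeticFunction.Moebius

namespace Literature.NumberTheory.LFunctions.LFDSingle

variable {q : ℕ}
variable {W X Y : ℝ}

/-! ### The Euler factor at the primes dividing `q` -/

/-- `E_q(s) = Π_{p ∣ q} (1 − p^{-s})`, so that `L(s, χ₀) = E_q(s) ζ(s)`. [folklore] -/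
def eulerQ (q : ℕ) (s : ℂ) : ℂ := ∏ p ∈ q.primeFactors, (1 - (p : ℂ) ^ (-s))

/-- `E_q` is entire. [folklore] -/
theorem differentiable_eulerQ (q : ℕ) : Differentiable ℂ (eulerQ q) := by
  have h : Differentiable ℂ (∏ p ∈ q.primeFactors, fun s : ℂ => 1 - (p : ℂ) ^ (-s)) := by
    refine Differentiable.finsetProd fun p hp => ?_
    have hp0 : (p : ℂ) ≠ 0 := by exact_mod_cast (Nat.prime_of_mem_primeFactors hp).ne_zero
    exact (differentiable_const _).sub (differentiable_id.neg.const_cpow (Or.inl hp0))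
  have heq : eulerQ q = ∏ p ∈ q.primeFactors, fun s : ℂ => 1 - (p : ℂ) ^ (-s) := by
    ext s; simp [eulerQ, Finset.prod_apply]
  rw [heq]; exact h

/-- `‖E_q(s)‖ ≤ 2^{ω(q)}` for `re s ≥ 0`. [folklore] -/
theorem norm_eulerQ_le (q : ℕ) {s : ℂ} (hs : 0 ≤ s.re) : ‖eulerQ q s‖ ≤ 2 ^ q.primeFactors.card := by
  unfold eulerQ
  rw [norm_prod, ← prod_const]
  refine prod_le_prod (fun p _ => norm_nonneg _) fun p hp => ?_
  have hpr := Nat.prime_of_mem_primeFactors hp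
  have hp1 : (1 : ℝ) ≤ p := by exact_mod_cast hpr.one_le
  calc ‖1 - (p : ℂ) ^ (-s)‖ ≤ ‖(1 : ℂ)‖ + ‖(p : ℂ) ^ (-s)‖ := norm_sub_le _ _
    _ ≤ 1 + 1 := by
        rw [norm_one, Complex.norm_natCast_cpow_of_pos hpr.pos, Complex.neg_re]
        gcongr
        exact Real.rpow_le_one_of_one_le_of_nonpos hp1 (by linarith)
    _ = 2 := by norm_num

/-- `E_q(1) = φ(q)/q`. [folklore] -/
theorem eulerQ_one (hq : q ≠ 0) : eulerQ q 1 = ((q.totient : ℝ) / q : ℝ) := by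
  have h := Literature.NumberTheory.LFunctions.MertensBound.totient_eq_mul_prod_one_sub_inv q
  have hq' : (q : ℝ) ≠ 0 := by exact_mod_cast hq
  have : (q.totient : ℝ) / q = ∏ p ∈ q.primeFactors, (1 - 1 / (p : ℝ)) := by
    rw [h]; field_simp
  rw [this, eulerQ]
  push_cast
  refine prod_congr rfl fun p hp => ?_
  have hp0 : (p : ℂ) ≠ 0 := by exact_mod_cast (Nat.prime_of_mem_primeFactors hp).ne_zero
  rw [Complex.cpow_neg_one, one_div]

/-- `L(s, χ₀) = E_q(s) ζ(s)` for `s ≠ 1` (Mathlib). [folklore] -/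
theorem LFunction_one_eq [NeZero q] {s : ℂ} (hs : s ≠ 1) :
    (1 : DirichletCharacter ℂ q).LFunction s = eulerQ q s * riemannZeta s :=
  DirichletCharacter.LFunctionTrivChar_eq_mul_riemannZeta (N := q) hs

/-! ### The Gram series and its integrand -/

/-- `g(n) n^{-κ}` with `g(n) = (θ∗1)(n)² χ₀(n)`: this is `bcoef 1 1 W W κ` of part I. The Gram sum is
`G(κ) = Σ_n g(n) n^{-κ} (e^{-n/X} − e^{-n/Y})`. [cite: HeathBrown1992PLMS, §11 (11.15)] -/
def gramSum (W X Y : ℝ) (κ : ℂ) : ℂ :=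
  (∑' n : ℕ, (if n = 0 then 0 else bcoef (1 : DirichletCharacter ℂ q) 1 W W κ n *
    (Real.exp (-(n * X⁻¹)) : ℂ))) -
  ∑' n : ℕ, (if n = 0 then 0 else bcoef (1 : DirichletCharacter ℂ q) 1 W W κ n *
    (Real.exp (-(n * Y⁻¹)) : ℂ))

/-- The integrand `H(w) = E_q(κ+w) ζ₁(κ+w)/(w − (1−κ)) · D_q(κ+w) (X^w − Y^w) Γ(w)`
(`= L(κ+w, χ₀) D_q(κ+w)(X^w − Y^w)Γ(w)` off `w = 1 − κ`). [cite: HeathBrown1992PLMS, §11 (11.16)] -/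
def gramIntegrand (W X Y : ℝ) (κ w : ℂ) : ℂ :=
  eulerQ q (κ + w) * riemannZeta₁ (κ + w) / (w - (1 - κ)) *
    Fpoly (1 : DirichletCharacter ℂ q) 1 W W (κ + w) * ((X : ℂ) ^ w - (Y : ℂ) ^ w) * Complex.Gamma w

/-- Off the pole: `H(w) = L(κ+w, χ₀) D_q(κ+w)(X^w − Y^w)Γ(w)` for `w ≠ 1 − κ`. [folklore] -/
theorem gramIntegrand_eq_LFunction [NeZero q] (W X Y : ℝ) (κ : ℂ) {w : ℂ} (hw : w ≠ 1 - κ) :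
    gramIntegrand (q := q) W X Y κ w = (1 : DirichletCharacter ℂ q).LFunction (κ + w) *
      Fpoly (1 : DirichletCharacter ℂ q) 1 W W (κ + w) * ((X : ℂ) ^ w - (Y : ℂ) ^ w) * Complex.Gamma w := by
  have hs : κ + w ≠ 1 := fun h => hw (by linear_combination h)
  rw [gramIntegrand, LFunction_one_eq hs, riemannZeta_eq_inv_sub_mul hs]
  have : κ + w - 1 = w - (1 - κ) := by ring
  rw [this]
  field_simp


/-! ### Differentiability and the two poles -/

/-- Abbreviation for the trivial character's weights polynomial `D_q = Fpoly 1 1 W W`. [folklore] -/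
theorem differentiable_Dq (W : ℝ) :
    Differentiable ℂ (Fpoly (1 : DirichletCharacter ℂ q) 1 W W) := differentiable_Fpoly _

/-- `H` is differentiable on `{re w > -1} ∖ {0, 1 − κ}`. [folklore] -/
theorem differentiableOn_gramIntegrand (hX : 0 < X) (hY : 0 < Y) (W : ℝ) (κ : ℂ) :
    DifferentiableOn ℂ (gramIntegrand (q := q) W X Y κ) ({w : ℂ | -1 < w.re} \ {0, 1 - κ}) := by
  intro w hw
  simp only [Set.mem_sdiff, Set.mem_setOf_eq, Set.mem_insert_iff, Set.mem_singleton_iff,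
    not_or] at hw
  obtain ⟨hw1, hw0, hwκ⟩ := hw
  have haff : DifferentiableAt ℂ (fun w : ℂ => κ + w) w := (differentiableAt_const _).add differentiableAt_id
  have h1 : DifferentiableAt ℂ (fun w => eulerQ q (κ + w)) w := ((differentiable_eulerQ q) _).comp w haff
  have h2 : DifferentiableAt ℂ (fun w => riemannZeta₁ (κ + w)) w := (differentiable_riemannZeta₁ _).comp w haff
  have h3 : DifferentiableAt ℂ (fun w : ℂ => w - (1 - κ)) w := differentiableAt_id.sub_const _
  have h4 : DifferentiableAt ℂ (fun w => Fpoly (1 : DirichletCharacter ℂ q) 1 W W (κ + w)) w :=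
    ((differentiable_Dq W) _).comp w haff
  have h5 : DifferentiableAt ℂ (fun w => (X : ℂ) ^ w - (Y : ℂ) ^ w) w :=
    (differentiableAt_id.const_cpow (Or.inl (by exact_mod_cast hX.ne'))).sub
      (differentiableAt_id.const_cpow (Or.inl (by exact_mod_cast hY.ne')))
  have h6 : DifferentiableAt ℂ Complex.Gamma w := by
    refine Complex.differentiableAt_Gamma _ fun m h => ?_
    rcases Nat.eq_zero_or_pos m with rfl | hm
    · exact hw0 (by simpa using h)
    · have := congrArg Complex.re h
      simp at this
      have : (1 : ℝ) ≤ m := by exact_mod_cast hm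
      linarith
  have hsub : w - (1 - κ) ≠ 0 := sub_ne_zero.2 hwκ
  exact ((((h1.mul h2).div h3 hsub).mul h4).mul h5 |>.mul h6).differentiableWithinAt

/-- Near `w₁ = 1 − κ`: `H = φ₁/(w − w₁)` with
`φ₁(w) = E_q(κ+w) ζ₁(κ+w) D_q(κ+w)(X^w − Y^w)Γ(w)`, differentiable on `{re w > 0}`. [folklore] -/
def gramNumer₁ (W X Y : ℝ) (κ w : ℂ) : ℂ :=
  eulerQ q (κ + w) * riemannZeta₁ (κ + w) *
    Fpoly (1 : DirichletCharacter ℂ q) 1 W W (κ + w) * ((X : ℂ) ^ w - (Y : ℂ) ^ w) * Complex.Gamma w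

/-- Differentiability of `φ₁` on the right half-plane. [folklore] -/
theorem differentiableOn_gramNumer₁ (hX : 0 < X) (hY : 0 < Y) (W : ℝ) (κ : ℂ) :
    DifferentiableOn ℂ (gramNumer₁ (q := q) W X Y κ) {w : ℂ | 0 < w.re} := by
  intro w hw
  have hw' : 0 < w.re := hw
  have haff : DifferentiableAt ℂ (fun w : ℂ => κ + w) w := (differentiableAt_const _).add differentiableAt_id
  have h1 : DifferentiableAt ℂ (fun w => eulerQ q (κ + w)) w := ((differentiable_eulerQ q) _).comp w haff
  have h2 : DifferentiableAt ℂ (fun w => riemannZeta₁ (κ + w)) w := (differentiable_riemannZeta₁ _).comp w haff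
  have h4 : DifferentiableAt ℂ (fun w => Fpoly (1 : DirichletCharacter ℂ q) 1 W W (κ + w)) w :=
    ((differentiable_Dq W) _).comp w haff
  have h5 : DifferentiableAt ℂ (fun w => (X : ℂ) ^ w - (Y : ℂ) ^ w) w :=
    (differentiableAt_id.const_cpow (Or.inl (by exact_mod_cast hX.ne'))).sub
      (differentiableAt_id.const_cpow (Or.inl (by exact_mod_cast hY.ne')))
  have h6 : DifferentiableAt ℂ Complex.Gamma w := by
    refine Complex.differentiableAt_Gamma _ fun m h => ?_
    have := congrArg Complex.re h
    simp at this
    have : (0 : ℝ) ≤ m := Nat.cast_nonneg m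
    linarith
  exact ((((h1.mul h2).mul h4).mul h5).mul h6).differentiableWithinAt

/-- `H(w) = φ₁(w)/(w − w₁)`. [folklore] -/
theorem gramIntegrand_eq_div₁ (W X Y : ℝ) (κ w : ℂ) :
    gramIntegrand (q := q) W X Y κ w = gramNumer₁ (q := q) W X Y κ w / (w - (1 - κ)) := by
  rw [gramIntegrand, gramNumer₁]; ring

/-- Near `0`: `H = φ₀/w` with `φ₀(w) = E ζ₁/(w − w₁) · D_q · (X^w − Y^w) · Γ(w + 1)`, differentiable on
`{re w > -1} ∖ {w₁}`, and `φ₀(0) = 0` (the zero of `X^w − Y^w`). [folklore] -/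
def gramNumer₀ (W X Y : ℝ) (κ w : ℂ) : ℂ :=
  eulerQ q (κ + w) * riemannZeta₁ (κ + w) / (w - (1 - κ)) *
    Fpoly (1 : DirichletCharacter ℂ q) 1 W W (κ + w) * ((X : ℂ) ^ w - (Y : ℂ) ^ w) * Complex.Gamma (w + 1)

/-- Differentiability of `φ₀`. [folklore] -/
theorem differentiableOn_gramNumer₀ (hX : 0 < X) (hY : 0 < Y) (W : ℝ) (κ : ℂ) :
    DifferentiableOn ℂ (gramNumer₀ (q := q) W X Y κ) ({w : ℂ | -1 < w.re} \ {1 - κ}) := by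
  intro w hw
  simp only [Set.mem_sdiff, Set.mem_setOf_eq, Set.mem_singleton_iff] at hw
  obtain ⟨hw1, hwκ⟩ := hw
  have haff : DifferentiableAt ℂ (fun w : ℂ => κ + w) w := (differentiableAt_const _).add differentiableAt_id
  have h1 : DifferentiableAt ℂ (fun w => eulerQ q (κ + w)) w := ((differentiable_eulerQ q) _).comp w haff
  have h2 : DifferentiableAt ℂ (fun w => riemannZeta₁ (κ + w)) w := (differentiable_riemannZeta₁ _).comp w haff
  have h3 : DifferentiableAt ℂ (fun w : ℂ => w - (1 - κ)) w := differentiableAt_id.sub_const _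
  have h4 : DifferentiableAt ℂ (fun w => Fpoly (1 : DirichletCharacter ℂ q) 1 W W (κ + w)) w :=
    ((differentiable_Dq W) _).comp w haff
  have h5 : DifferentiableAt ℂ (fun w => (X : ℂ) ^ w - (Y : ℂ) ^ w) w :=
    (differentiableAt_id.const_cpow (Or.inl (by exact_mod_cast hX.ne'))).sub
      (differentiableAt_id.const_cpow (Or.inl (by exact_mod_cast hY.ne')))
  have h6 : DifferentiableAt ℂ (fun w => Complex.Gamma (w + 1)) w := by
    refine (Complex.differentiableAt_Gamma _ fun m h => ?_).comp w (differentiableAt_id.add_const 1)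
    have := congrArg Complex.re h
    simp at this
    linarith
  have hsub : w - (1 - κ) ≠ 0 := sub_ne_zero.2 hwκ
  exact (((((h1.mul h2).div h3 hsub).mul h4).mul h5).mul h6).differentiableWithinAt

/-- `H(w) = φ₀(w)/w` for `w ≠ 0`. [folklore] -/
theorem gramIntegrand_eq_div₀ (W X Y : ℝ) (κ : ℂ) {w : ℂ} (hw : w ≠ 0) :
    gramIntegrand (q := q) W X Y κ w = gramNumer₀ (q := q) W X Y κ w / (w - 0) := by
  rw [sub_zero, gramIntegrand, gramNumer₀, Complex.Gamma_add_one w hw]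
  field_simp

/-- `φ₀(0) = 0`. [folklore] -/
theorem gramNumer₀_zero (W X Y : ℝ) (κ : ℂ) : gramNumer₀ (q := q) W X Y κ 0 = 0 := by
  simp [gramNumer₀]

/-! ### Norm estimates on the lines and on the horizontal segments -/

/-- `‖ζ(s)‖ ≤ 8 ‖s‖` for `1/4 ≤ re s ≤ 3/4` (Titchmarsh (2.12.2): `‖s‖/‖s−1‖ + ‖s‖/σ`, with
`‖s − 1‖ ≥ 1/4`, `σ ≥ 1/4`). [cite: Titchmarsh1986, §2.12 eq. (2.12.2)] -/
theorem norm_riemannZeta_le_eight_mul {s : ℂ} (hs : 1 / 4 ≤ s.re) (hs1 : s.re ≤ 3 / 4) :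
    ‖riemannZeta s‖ ≤ 8 * ‖s‖ := by
  have hne : s ≠ 1 := by intro h; rw [h] at hs1; norm_num at hs1
  have h := norm_riemannZeta_le_of_re_pos (by linarith) hne
  have h1 : (1 / 4 : ℝ) ≤ ‖s - 1‖ := by
    have := Complex.abs_re_le_norm (s - 1)
    rw [Complex.sub_re, Complex.one_re] at this
    have : |s.re - 1| = 1 - s.re := by rw [abs_of_nonpos (by linarith)]; ring
    linarith
  calc ‖riemannZeta s‖ ≤ ‖s‖ / ‖s - 1‖ + ‖s‖ / s.re := h
    _ ≤ ‖s‖ / (1 / 4) + ‖s‖ / (1 / 4) := by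
        gcongr
    _ = 8 * ‖s‖ := by ring

/-- The same in the form valid for all `s` with `re s ≥ 1/4` and `|im s| ≥ 1`: `‖ζ(s)‖ ≤ 5 ‖s‖`.
[cite: Titchmarsh1986, §2.12 eq. (2.12.2)] -/
theorem norm_riemannZeta_le_five_mul {s : ℂ} (hs : 1 / 4 ≤ s.re) (him : 1 ≤ |s.im|) :
    ‖riemannZeta s‖ ≤ 5 * ‖s‖ := by
  have hne : s ≠ 1 := by intro h; rw [h] at him; norm_num at him
  have h := norm_riemannZeta_le_of_re_pos (by linarith) hne
  have h1 : (1 : ℝ) ≤ ‖s - 1‖ := by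
    have := Complex.abs_im_le_norm (s - 1)
    rw [Complex.sub_im, Complex.one_im, sub_zero] at this
    linarith
  calc ‖riemannZeta s‖ ≤ ‖s‖ / ‖s - 1‖ + ‖s‖ / s.re := h
    _ ≤ ‖s‖ / 1 + ‖s‖ / (1 / 4) := by gcongr
    _ = 5 * ‖s‖ := by ring

/-- `‖X^w − Y^w‖ ≤ 2 max(X, Y)^{re w}`-type bound in the crude form used on the lines:
`‖X^w − Y^w‖ ≤ X^{re w} + Y^{re w}`. [folklore] -/
theorem norm_cpow_sub_cpow_le (hX : 0 < X) (hY : 0 < Y) (w : ℂ) :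
    ‖(X : ℂ) ^ w - (Y : ℂ) ^ w‖ ≤ X ^ w.re + Y ^ w.re := by
  calc ‖(X : ℂ) ^ w - (Y : ℂ) ^ w‖ ≤ ‖(X : ℂ) ^ w‖ + ‖(Y : ℂ) ^ w‖ := norm_sub_le _ _
    _ = X ^ w.re + Y ^ w.re := by
        rw [Complex.norm_cpow_eq_rpow_re_of_pos hX, Complex.norm_cpow_eq_rpow_re_of_pos hY]

/-- The left line `re w = -1/4`: for `1/2 ≤ re κ ≤ 1`, `1 < W`, `1 ≤ Y ≤ X`,
`‖H(-1/4 + iy)‖ ≤ K₂ (1+|y|)^{5/2} e^{-π|y|/2}`,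
`K₂ = (4096π²/3) 2^{ω(q)} (1 + ‖κ‖) ⌊W⌋² Y^{-1/4}`. [cite: HeathBrown1992PLMS, §11 (11.16)] -/
theorem norm_gramIntegrand_left_le [NeZero q] (hX : 0 < X) (hY : 0 < Y) (hW : 1 < W) (hYX : Y ≤ X) {κ : ℂ}
    (hκ : 1 / 2 ≤ κ.re) (hκ1 : κ.re ≤ 1) (y : ℝ) :
    ‖gramIntegrand (q := q) W X Y κ ((-1 / 4 : ℝ) + y * I)‖ ≤
      (4096 * π ^ 2 / 3 * 2 ^ q.primeFactors.card * (1 + ‖κ‖) * ((⌊W⌋₊ : ℝ) * ⌊W⌋₊) *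
        Y ^ (-(1 / 4 : ℝ))) * ((1 + |y|) ^ (5 / 2 : ℝ) * Real.exp (-(π * |y|) / 2)) := by
  set w : ℂ := ((-1 / 4 : ℝ) : ℂ) + y * I with hw
  have hwre : w.re = -1 / 4 := by simp [hw]
  have hre : (κ + w).re = κ.re - 1 / 4 := by rw [Complex.add_re, hwre]; ring
  have hne : w ≠ 1 - κ := by
    intro h; have := congrArg Complex.re h; rw [hwre, Complex.sub_re, Complex.one_re] at this; linarith
  rw [gramIntegrand_eq_LFunction W X Y κ hne, LFunction_one_eq (by
    intro h; have := congrArg Complex.re h; rw [hre, Complex.one_re] at this; linarith)]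
  -- the factors
  have hE : ‖eulerQ q (κ + w)‖ ≤ 2 ^ q.primeFactors.card := norm_eulerQ_le q (by rw [hre]; linarith)
  have hζ : ‖riemannZeta (κ + w)‖ ≤ 8 * ((1 + ‖κ‖) * (1 + |y|)) := by
    refine (norm_riemannZeta_le_eight_mul (by rw [hre]; linarith) (by rw [hre]; linarith)).trans ?_
    refine mul_le_mul_of_nonneg_left ?_ (by norm_num)
    calc ‖κ + w‖ ≤ ‖κ‖ + ‖w‖ := norm_add_le _ _
      _ ≤ ‖κ‖ + (|(-1 / 4 : ℝ)| + |y|) := by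
          gcongr
          have := Complex.norm_le_abs_re_add_abs_im w
          simpa [hw] using this
      _ ≤ (1 + ‖κ‖) * (1 + |y|) := by
          rw [show |(-1 / 4 : ℝ)| = 1 / 4 by norm_num [abs_of_neg]]
          nlinarith [norm_nonneg κ, abs_nonneg y]
  have hD : ‖Fpoly (1 : DirichletCharacter ℂ q) 1 W W (κ + w)‖ ≤ (⌊W⌋₊ : ℝ) * ⌊W⌋₊ :=
    norm_Fpoly_le _ le_rfl hW hW (by rw [hre]; linarith)
  have hXY : ‖(X : ℂ) ^ w - (Y : ℂ) ^ w‖ ≤ 2 * Y ^ (-(1 / 4 : ℝ)) := by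
    refine (norm_cpow_sub_cpow_le hX hY w).trans ?_
    rw [hwre, show (-1 / 4 : ℝ) = -(1 / 4) by norm_num]
    have : X ^ (-(1 / 4 : ℝ)) ≤ Y ^ (-(1 / 4 : ℝ)) :=
      Real.rpow_le_rpow_of_nonpos hY hYX (by norm_num)
    linarith
  have hne0 : ((-1 / 4 : ℝ) : ℂ) + y * I ≠ 0 := by
    intro h; have := congrArg Complex.re h; simp at this
  have hne1 : ((-1 / 4 : ℝ) : ℂ) + y * I + 1 ≠ 0 := by
    intro h; have := congrArg Complex.re h; norm_num at this
  have hn1 : (1 / 4 : ℝ) ≤ ‖((-1 / 4 : ℝ) : ℂ) + y * I‖ := by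
    have : |(-1 / 4 : ℝ)| ≤ ‖((-1 / 4 : ℝ) : ℂ) + y * I‖ := by
      simpa using Complex.abs_re_le_norm (((-1 / 4 : ℝ) : ℂ) + y * I)
    norm_num [abs_of_neg] at this ⊢
    exact this
  have hn2 : (3 / 4 : ℝ) ≤ ‖((-1 / 4 : ℝ) : ℂ) + y * I + 1‖ := by
    have : |(3 / 4 : ℝ)| ≤ ‖((3 / 4 : ℝ) : ℂ) + y * I‖ := by
      simpa using Complex.abs_re_le_norm (((3 / 4 : ℝ) : ℂ) + y * I)
    rw [show ((3 / 4 : ℝ) : ℂ) + y * I = ((-1 / 4 : ℝ) : ℂ) + y * I + 1 by push_cast; ring] at this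
    norm_num [abs_of_pos] at this ⊢
    exact this
  have hΓ : ‖Complex.Gamma w‖ ≤ (16 / 3) * (16 * π ^ 2 * (1 + |y|) ^ (3 / 2 : ℝ) * Real.exp (-(π * |y|) / 2)) := by
    rw [hw]
    refine (norm_Gamma_le_step₂ (x := -1 / 4) (by norm_num) (by norm_num) hne0 hne1).trans ?_
    rw [div_le_iff₀ (by positivity)]
    have hprod : (3 / 16 : ℝ) ≤ ‖((-1 / 4 : ℝ) : ℂ) + y * I‖ * ‖((-1 / 4 : ℝ) : ℂ) + y * I + 1‖ := by
      nlinarith [norm_nonneg (((-1 / 4 : ℝ) : ℂ) + y * I), norm_nonneg (((-1 / 4 : ℝ) : ℂ) + y * I + 1)]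
    have h0 : 0 ≤ 16 * π ^ 2 * (1 + |y|) ^ (3 / 2 : ℝ) * Real.exp (-(π * |y|) / 2) := by positivity
    nlinarith
  have hy32 : (1 + |y|) * (1 + |y|) ^ (3 / 2 : ℝ) = (1 + |y|) ^ (5 / 2 : ℝ) := by
    rw [← Real.rpow_one_add' (by positivity) (by norm_num)]; norm_num
  rw [norm_mul, norm_mul, norm_mul, norm_mul]
  calc ‖eulerQ q (κ + w)‖ * ‖riemannZeta (κ + w)‖ * ‖Fpoly (1 : DirichletCharacter ℂ q) 1 W W (κ + w)‖ *
        ‖(X : ℂ) ^ w - (Y : ℂ) ^ w‖ * ‖Complex.Gamma w‖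
      ≤ 2 ^ q.primeFactors.card * (8 * ((1 + ‖κ‖) * (1 + |y|))) * ((⌊W⌋₊ : ℝ) * ⌊W⌋₊) *
        (2 * Y ^ (-(1 / 4 : ℝ))) *
        ((16 / 3) * (16 * π ^ 2 * (1 + |y|) ^ (3 / 2 : ℝ) * Real.exp (-(π * |y|) / 2))) := by
        gcongr
    _ = (4096 * π ^ 2 / 3 * 2 ^ q.primeFactors.card * (1 + ‖κ‖) * ((⌊W⌋₊ : ℝ) * ⌊W⌋₊) *
        Y ^ (-(1 / 4 : ℝ))) * (((1 + |y|) * (1 + |y|) ^ (3 / 2 : ℝ)) * Real.exp (-(π * |y|) / 2)) := by ring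
    _ = _ := by rw [hy32]

/-- `‖L(s, χ₀)‖ ≤ 3` for `re s ≥ 3/2`. [folklore] -/
theorem norm_LFunction_one_le_three [NeZero q] {s : ℂ} (hs : 3 / 2 ≤ s.re) :
    ‖(1 : DirichletCharacter ℂ q).LFunction s‖ ≤ 3 := norm_LFunction_le_three _ hs

/-- The right line `re w = 1`: for `re κ ≥ 1/2`, `1 < W`, `0 < Y ≤ X`:
`‖H(1 + iy)‖ ≤ 3 ⌊W⌋² (2X) · 16π²(1+|y|)^{3/2}e^{-π|y|/2}`. [folklore] -/
theorem norm_gramIntegrand_right_le [NeZero q] (hX : 0 < X) (hY : 0 < Y) (hW : 1 < W) (hYX : Y ≤ X) {κ : ℂ} (hκ : 1 / 2 ≤ κ.re)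
    (y : ℝ) :
    ‖gramIntegrand (q := q) W X Y κ (1 + y * I)‖ ≤
      3 * ((⌊W⌋₊ : ℝ) * ⌊W⌋₊) * (2 * X) * (16 * π ^ 2 * (1 + |y|) ^ (3 / 2 : ℝ) * Real.exp (-(π * |y|) / 2)) := by
  have hre : (κ + (1 + y * I)).re = κ.re + 1 := by simp
  have hne : (1 : ℂ) + y * I ≠ 1 - κ := by
    intro h; have := congrArg Complex.re h; simp at this; linarith
  rw [gramIntegrand_eq_LFunction W X Y κ hne]
  have h1 : ‖(1 : DirichletCharacter ℂ q).LFunction (κ + (1 + y * I))‖ ≤ 3 :=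
    norm_LFunction_one_le_three (by rw [hre]; linarith)
  have h2 : ‖Fpoly (1 : DirichletCharacter ℂ q) 1 W W (κ + (1 + y * I))‖ ≤ (⌊W⌋₊ : ℝ) * ⌊W⌋₊ :=
    norm_Fpoly_le _ le_rfl hW hW (by rw [hre]; linarith)
  have h3 : ‖(X : ℂ) ^ (1 + y * I) - (Y : ℂ) ^ (1 + y * I)‖ ≤ 2 * X := by
    refine (norm_cpow_sub_cpow_le hX hY _).trans ?_
    simp only [Complex.add_re, Complex.one_re, Complex.mul_re, Complex.ofReal_re, Complex.I_re,
      mul_zero, Complex.ofReal_im, Complex.I_im, mul_one, sub_self, add_zero, Real.rpow_one]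
    linarith
  have h4 := Literature.Analysis.SpecialFunctions.norm_Gamma_le_of_mem_Icc (x := 1) le_rfl (by norm_num) y
  simp only [Complex.ofReal_one] at h4
  rw [norm_mul, norm_mul, norm_mul]
  gcongr

/-- Uniform smallness of `H` on the horizontal segments `[-1/4, 1] + iT`, `|T| → ∞`
(`1 ≤ Y ≤ X`). [folklore] -/
theorem decay_gramIntegrand [NeZero q] (hX : 0 < X) (hY : 0 < Y) (hW : 1 < W) (hY1 : 1 ≤ Y) (hYX : Y ≤ X) {κ : ℂ}
    (hκ : 1 / 2 ≤ κ.re) :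
    ∀ ε : ℝ, 0 < ε → ∃ T₀ : ℝ, ∀ T : ℝ, T₀ ≤ |T| → ∀ x ∈ Set.Icc (-1 / 4 : ℝ) 1,
      ‖gramIntegrand (q := q) W X Y κ (x + T * I)‖ ≤ ε := by
  have hX1 : 1 ≤ X := hY1.trans hYX
  set C : ℝ := 2 ^ q.primeFactors.card * (5 * (‖κ‖ + 2)) * ((⌊W⌋₊ : ℝ) * ⌊W⌋₊) * (2 * X) *
    (16 * π ^ 2) * 1024 with hC
  have h := Literature.Analysis.Complex.VLI.decay_of_norm_le_div (F := gramIntegrand (q := q) W X Y κ)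
    (a := -1 / 4) (b := 1) (C := C) (R := |κ.im| + 1) ?_
  · intro ε hε
    obtain ⟨T₀, hT₀⟩ := h ε hε
    exact ⟨T₀, fun T hT x hx => hT₀ x hx T hT⟩
  intro x hx T hT
  have hT1 : 1 ≤ |T| := by linarith [abs_nonneg κ.im]
  have hT0 : 0 < |T| := by linarith
  set w : ℂ := (x : ℂ) + T * I with hw
  have hwre : w.re = x := by simp [hw]
  have hre : (κ + w).re = κ.re + x := by rw [Complex.add_re, hwre]
  have him : 1 ≤ |(κ + w).im| := by
    have : (κ + w).im = κ.im + T := by simp [hw]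
    rw [this]
    have := abs_add_le (κ.im + T) (-κ.im)
    rw [show κ.im + T + -κ.im = T by ring, abs_neg] at this
    linarith
  have hne : w ≠ 1 - κ := by
    intro h
    have : (κ + w).im = 0 := by rw [h]; simp
    rw [this] at him; norm_num at him
  rw [gramIntegrand_eq_LFunction W X Y κ hne, LFunction_one_eq (by
    intro h; have := congrArg Complex.im h; rw [Complex.one_im] at this; rw [this] at him; norm_num at him)]
  have hE : ‖eulerQ q (κ + w)‖ ≤ 2 ^ q.primeFactors.card := norm_eulerQ_le q (by rw [hre]; linarith [hx.1])
  have hζ : ‖riemannZeta (κ + w)‖ ≤ 5 * ((‖κ‖ + 2) * (1 + |T|)) := by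
    refine (norm_riemannZeta_le_five_mul (by rw [hre]; linarith [hx.1]) him).trans ?_
    refine mul_le_mul_of_nonneg_left ?_ (by norm_num)
    calc ‖κ + w‖ ≤ ‖κ‖ + ‖w‖ := norm_add_le _ _
      _ ≤ ‖κ‖ + (|x| + |T|) := by
          gcongr; exact (Complex.norm_le_abs_re_add_abs_im w).trans (by simp [hw])
      _ ≤ (‖κ‖ + 2) * (1 + |T|) := by
          have hx1 : |x| ≤ 1 := abs_le.2 ⟨by linarith [hx.1], hx.2⟩
          nlinarith [norm_nonneg κ, abs_nonneg T]
  have hD : ‖Fpoly (1 : DirichletCharacter ℂ q) 1 W W (κ + w)‖ ≤ (⌊W⌋₊ : ℝ) * ⌊W⌋₊ :=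
    norm_Fpoly_le _ le_rfl hW hW (by rw [hre]; linarith [hx.1])
  have hXY : ‖(X : ℂ) ^ w - (Y : ℂ) ^ w‖ ≤ 2 * X := by
    refine (norm_cpow_sub_cpow_le hX hY w).trans ?_
    rw [hwre]
    have h1 : X ^ x ≤ X ^ (1 : ℝ) := Real.rpow_le_rpow_of_exponent_le hX1 hx.2
    have h2 : Y ^ x ≤ Y ^ (1 : ℝ) := Real.rpow_le_rpow_of_exponent_le hY1 hx.2
    rw [Real.rpow_one] at h1 h2
    linarith
  have hΓ := norm_Gamma_strip_le hx.1 hx.2 hT1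
  have h5 : (1 + |T|) * ((1 + |T|) ^ (3 / 2 : ℝ) * Real.exp (-(π * |T|) / 2)) ≤ 1024 := by
    have e : (1 + |T|) * ((1 + |T|) ^ (3 / 2 : ℝ) * Real.exp (-(π * |T|) / 2)) =
        (1 + |T|) ^ (5 / 2 : ℝ) * Real.exp (-(π * |T|) / 2) := by
      rw [← mul_assoc, ← Real.rpow_one_add' (by positivity) (by norm_num)]; norm_num
    rw [e]
    refine (rpow_mul_exp_le_inv_one_add_sq T).trans ?_
    have : (1 + T ^ 2)⁻¹ ≤ 1 := inv_le_one_of_one_le₀ (by nlinarith)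
    linarith
  rw [norm_mul, norm_mul, norm_mul, norm_mul]
  calc ‖eulerQ q (κ + w)‖ * ‖riemannZeta (κ + w)‖ * ‖Fpoly (1 : DirichletCharacter ℂ q) 1 W W (κ + w)‖ *
        ‖(X : ℂ) ^ w - (Y : ℂ) ^ w‖ * ‖Complex.Gamma w‖
      ≤ 2 ^ q.primeFactors.card * (5 * ((‖κ‖ + 2) * (1 + |T|))) * ((⌊W⌋₊ : ℝ) * ⌊W⌋₊) * (2 * X) *
        (16 * π ^ 2 * (1 + |T|) ^ (3 / 2 : ℝ) * Real.exp (-(π * |T|) / 2) / |T|) := by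
        have hΓ' : ‖Complex.Gamma w‖ ≤
            16 * π ^ 2 * (1 + |T|) ^ (3 / 2 : ℝ) * Real.exp (-(π * |T|) / 2) / |T| := by rw [hw]; exact hΓ
        gcongr
    _ = 2 ^ q.primeFactors.card * (5 * (‖κ‖ + 2)) * ((⌊W⌋₊ : ℝ) * ⌊W⌋₊) * (2 * X) * (16 * π ^ 2) *
        ((1 + |T|) * ((1 + |T|) ^ (3 / 2 : ℝ) * Real.exp (-(π * |T|) / 2))) / |T| := by
        field_simp
    _ ≤ 2 ^ q.primeFactors.card * (5 * (‖κ‖ + 2)) * ((⌊W⌋₊ : ℝ) * ⌊W⌋₊) * (2 * X) * (16 * π ^ 2) *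
        1024 / |T| := by
        have : (0 : ℝ) ≤ X := hX.le
        gcongr
    _ = C / |T| := by rw [hC]

/-- Integrability along the right line. [folklore] -/
theorem integrable_gramIntegrand_right [NeZero q] (hX : 0 < X) (hY : 0 < Y) (hW : 1 < W) (hY1 : 1 ≤ Y)
    (hYX : Y ≤ X) {κ : ℂ} (hκ : 1 / 2 ≤ κ.re) :
    Integrable fun y : ℝ => gramIntegrand (q := q) W X Y κ (1 + y * I) := by
  have hX1 : 1 ≤ X := hY1.trans hYX
  have hdiff := differentiableOn_gramIntegrand hX hY W κ (q := q)
  have hcont : Continuous fun y : ℝ => gramIntegrand (q := q) W X Y κ (1 + y * I) := by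
    have hline : Continuous fun y : ℝ => (1 : ℂ) + y * I := by fun_prop
    refine hdiff.continuousOn.comp_continuous hline fun y => ?_
    simp only [Set.mem_sdiff, Set.mem_setOf_eq, Set.mem_insert_iff, Set.mem_singleton_iff, not_or]
    refine ⟨by simp, fun h => ?_, fun h => ?_⟩
    · have := congrArg Complex.re h; simp at this
    · have := congrArg Complex.re h; simp at this; linarith
  refine Literature.Analysis.Complex.VLI.integrable_of_continuous_of_norm_le hcont (R := 0)
    (C := 3 * ((⌊W⌋₊ : ℝ) * ⌊W⌋₊) * (2 * X) * (16 * π ^ 2) * 1024) fun y _ => ?_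
  refine (norm_gramIntegrand_right_le hX hY hW hYX hκ y).trans ?_
  have h1 : (1 + |y|) ^ (3 / 2 : ℝ) ≤ (1 + |y|) ^ (5 / 2 : ℝ) :=
    Real.rpow_le_rpow_of_exponent_le (by linarith [abs_nonneg y]) (by norm_num)
  have h2 := rpow_mul_exp_le_inv_one_add_sq y
  have h0 : 0 ≤ 3 * ((⌊W⌋₊ : ℝ) * ⌊W⌋₊) * (2 * X) * (16 * π ^ 2) := by
    have := hX.le; positivity
  calc 3 * ((⌊W⌋₊ : ℝ) * ⌊W⌋₊) * (2 * X) * (16 * π ^ 2 * (1 + |y|) ^ (3 / 2 : ℝ) * Real.exp (-(π * |y|) / 2))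
      = 3 * ((⌊W⌋₊ : ℝ) * ⌊W⌋₊) * (2 * X) * (16 * π ^ 2) * ((1 + |y|) ^ (3 / 2 : ℝ) * Real.exp (-(π * |y|) / 2)) := by ring
    _ ≤ 3 * ((⌊W⌋₊ : ℝ) * ⌊W⌋₊) * (2 * X) * (16 * π ^ 2) * ((1 + |y|) ^ (5 / 2 : ℝ) * Real.exp (-(π * |y|) / 2)) := by
        gcongr
    _ ≤ 3 * ((⌊W⌋₊ : ℝ) * ⌊W⌋₊) * (2 * X) * (16 * π ^ 2) * (1024 * (1 + y ^ 2)⁻¹) :=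
        mul_le_mul_of_nonneg_left h2 h0
    _ = _ := by ring

/-- Integrability along the left line. [folklore] -/
theorem integrable_gramIntegrand_left [NeZero q] (hX : 0 < X) (hY : 0 < Y) (hW : 1 < W) (hYX : Y ≤ X) {κ : ℂ}
    (hκ : 1 / 2 ≤ κ.re) (hκ1 : κ.re ≤ 1) :
    Integrable fun y : ℝ => gramIntegrand (q := q) W X Y κ ((-1 / 4 : ℝ) + y * I) := by
  have hdiff := differentiableOn_gramIntegrand hX hY W κ (q := q)
  have hcont : Continuous fun y : ℝ => gramIntegrand (q := q) W X Y κ ((-1 / 4 : ℝ) + y * I) := by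
    have hline : Continuous fun y : ℝ => ((-1 / 4 : ℝ) : ℂ) + y * I := by fun_prop
    refine hdiff.continuousOn.comp_continuous hline fun y => ?_
    simp only [Set.mem_sdiff, Set.mem_setOf_eq, Set.mem_insert_iff, Set.mem_singleton_iff, not_or]
    refine ⟨by simp; norm_num, fun h => ?_, fun h => ?_⟩
    · have := congrArg Complex.re h; simp at this
    · have := congrArg Complex.re h; simp at this; linarith
  set K : ℝ := 4096 * π ^ 2 / 3 * 2 ^ q.primeFactors.card * (1 + ‖κ‖) * ((⌊W⌋₊ : ℝ) * ⌊W⌋₊) *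
    Y ^ (-(1 / 4 : ℝ)) with hK
  have hK0 : 0 ≤ K := by rw [hK]; positivity
  refine Literature.Analysis.Complex.VLI.integrable_of_continuous_of_norm_le hcont (R := 0)
    (C := K * 1024) fun y _ => ?_
  calc ‖gramIntegrand (q := q) W X Y κ ((-1 / 4 : ℝ) + y * I)‖
      ≤ K * ((1 + |y|) ^ (5 / 2 : ℝ) * Real.exp (-(π * |y|) / 2)) :=
        norm_gramIntegrand_left_le hX hY hW hYX hκ hκ1 y
    _ ≤ K * (1024 * (1 + y ^ 2)⁻¹) := mul_le_mul_of_nonneg_left (rpow_mul_exp_le_inv_one_add_sq y) hK0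
    _ = K * 1024 * (1 + y ^ 2)⁻¹ := by ring

/-! ### The identity for the Gram sum -/

/-- The single-cutoff integrand `L(κ+w, χ₀) D_q(κ+w) Z^w Γ(w)` on `re w = 1` is integrable
(`Z > 0`, `1/2 ≤ re κ`, `1 < W`). [folklore] -/
theorem integrable_single_right [NeZero q] (hW : 1 < W) {Z : ℝ} (hZ : 0 < Z) {κ : ℂ} (hκ : 1 / 2 ≤ κ.re) :
    Integrable fun y : ℝ => (1 : DirichletCharacter ℂ q).LFunction (κ + (1 + y * I)) *
      Fpoly (1 : DirichletCharacter ℂ q) 1 W W (κ + (1 + y * I)) * (Z : ℂ) ^ ((1 : ℂ) + y * I) *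
      Complex.Gamma (1 + y * I) := by
  have hline : Continuous fun y : ℝ => (1 : ℂ) + y * I := by fun_prop
  have hcont : Continuous fun y : ℝ => (1 : DirichletCharacter ℂ q).LFunction (κ + (1 + y * I)) *
      Fpoly (1 : DirichletCharacter ℂ q) 1 W W (κ + (1 + y * I)) * (Z : ℂ) ^ ((1 : ℂ) + y * I) *
      Complex.Gamma (1 + y * I) := by
    refine ((Continuous.mul (Continuous.mul ?_ ?_) ?_).mul ?_)
    · refine continuous_iff_continuousAt.2 fun y => ?_
      refine (DirichletCharacter.differentiableAt_LFunction _ _ (Or.inl ?_)).continuousAt.comp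
        (continuous_const.add hline).continuousAt
      intro h; have := congrArg Complex.re h; simp at this; linarith
    · exact (continuous_Fpoly _).comp (continuous_const.add hline)
    · exact Continuous.const_cpow hline (Or.inl (by exact_mod_cast hZ.ne'))
    · refine continuous_iff_continuousAt.2 fun y => ?_
      refine (Complex.differentiableAt_Gamma _ fun m h => ?_).continuousAt.comp hline.continuousAt
      have := congrArg Complex.re h; simp at this
      have : (0 : ℝ) ≤ m := Nat.cast_nonneg m; linarith
  refine Literature.Analysis.Complex.VLI.integrable_of_continuous_of_norm_le hcont (R := 0)
    (C := 3 * ((⌊W⌋₊ : ℝ) * ⌊W⌋₊) * Z * (16 * π ^ 2) * 1024) fun y _ => ?_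
  have hre : (κ + (1 + y * I)).re = κ.re + 1 := by simp
  have h1 : ‖(1 : DirichletCharacter ℂ q).LFunction (κ + (1 + y * I))‖ ≤ 3 :=
    norm_LFunction_one_le_three (by rw [hre]; linarith)
  have h2 : ‖Fpoly (1 : DirichletCharacter ℂ q) 1 W W (κ + (1 + y * I))‖ ≤ (⌊W⌋₊ : ℝ) * ⌊W⌋₊ :=
    norm_Fpoly_le _ le_rfl hW hW (by rw [hre]; linarith)
  have h3 : ‖(Z : ℂ) ^ ((1 : ℂ) + y * I)‖ = Z := by
    rw [Complex.norm_cpow_eq_rpow_re_of_pos hZ]; simp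
  have h4 := Literature.Analysis.SpecialFunctions.norm_Gamma_le_of_mem_Icc (x := 1) le_rfl (by norm_num) y
  simp only [Complex.ofReal_one] at h4
  have h5 : (1 + |y|) ^ (3 / 2 : ℝ) * Real.exp (-(π * |y|) / 2) ≤ 1024 * (1 + y ^ 2)⁻¹ :=
    (mul_le_mul_of_nonneg_right (Real.rpow_le_rpow_of_exponent_le (by linarith [abs_nonneg y])
      (by norm_num : (3 / 2 : ℝ) ≤ 5 / 2)) (Real.exp_nonneg _)).trans (rpow_mul_exp_le_inv_one_add_sq y)
  rw [norm_mul, norm_mul, norm_mul, h3]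
  calc ‖(1 : DirichletCharacter ℂ q).LFunction (κ + (1 + y * I))‖ *
        ‖Fpoly (1 : DirichletCharacter ℂ q) 1 W W (κ + (1 + y * I))‖ * Z * ‖Complex.Gamma (1 + y * I)‖
      ≤ 3 * ((⌊W⌋₊ : ℝ) * ⌊W⌋₊) * Z * (16 * π ^ 2 * (1 + |y|) ^ (3 / 2 : ℝ) * Real.exp (-(π * |y|) / 2)) := by
        gcongr
    _ = 3 * ((⌊W⌋₊ : ℝ) * ⌊W⌋₊) * Z * (16 * π ^ 2) * ((1 + |y|) ^ (3 / 2 : ℝ) * Real.exp (-(π * |y|) / 2)) := by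
        ring
    _ ≤ 3 * ((⌊W⌋₊ : ℝ) * ⌊W⌋₊) * Z * (16 * π ^ 2) * (1024 * (1 + y ^ 2)⁻¹) :=
        mul_le_mul_of_nonneg_left h5 (by have := hZ.le; positivity)
    _ = _ := by ring

/-- One Cahen–Mellin integral: `Σ_n g(n) n^{-κ} e^{-n/Z} = (1/2π)∫ L(κ+1+iy,χ₀) D_q(κ+1+iy) Z^{1+iy} Γ(1+iy) dy`
(`Z > 0`, `0 < re κ`, `1 < W`). [cite: HeathBrown1992PLMS, §11 (11.15)] -/
theorem tsum_single_eq_integral [NeZero q] (hW : 1 < W) {Z : ℝ} (hZ : 0 < Z) {κ : ℂ} (hκ : 0 < κ.re) :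
    ∑' n : ℕ, (if n = 0 then 0 else bcoef (1 : DirichletCharacter ℂ q) 1 W W κ n * (Real.exp (-(n * Z⁻¹)) : ℂ)) =
      (1 / (2 * π) : ℂ) * ∫ y : ℝ, (1 : DirichletCharacter ℂ q).LFunction (κ + (1 + y * I)) *
        Fpoly (1 : DirichletCharacter ℂ q) 1 W W (κ + (1 + y * I)) * (Z : ℂ) ^ ((1 : ℂ) + y * I) *
        Complex.Gamma (1 + y * I) := by
  set χ₀ : DirichletCharacter ℂ q := 1
  have hsum : LSeriesSummable (bcoef χ₀ 1 W W κ) ((1 : ℝ) : ℂ) :=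
    LSeriesSummable_bcoef χ₀ le_rfl hW hW κ (c := 1) (by linarith)
  have h := Literature.Analysis.Complex.tsum_mul_exp_neg_eq_integral_LSeries (bcoef χ₀ 1 W W κ)
    one_pos (by norm_num) hsum (inv_pos.2 hZ)
  simp only [Complex.ofReal_one] at h
  rw [h]
  congr 1
  refine integral_congr_ae (Filter.Eventually.of_forall fun y => ?_)
  have hre : 1 < (κ + (1 + y * I)).re := by simp; linarith
  simp only
  have inv_cpow_neg_eq : ∀ w : ℂ, ((Z⁻¹ : ℝ) : ℂ) ^ (-w) = (Z : ℂ) ^ w := fun w => by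
    rw [Complex.ofReal_inv, Complex.inv_cpow _ _ (by
      rw [Complex.arg_ofReal_of_nonneg hZ.le]; exact Real.pi_ne_zero.symm), Complex.cpow_neg, inv_inv]
  rw [LSeries_bcoef, LSeries_coefChi_eq χ₀ le_rfl hW hW hre, inv_cpow_neg_eq]
  ring

/-- **Cahen–Mellin for the Gram sum**: for `1 ≤ Y ≤ X`, `1 < W` and `1/2 ≤ re κ < 1`,
`G(κ) = (1/2π) ∫ H(1 + iy) dy`. [cite: HeathBrown1992PLMS, §11 (11.15)] -/
theorem gramSum_eq_integral [NeZero q] (hX : 0 < X) (hY : 0 < Y) (hW : 1 < W) {κ : ℂ} (hκ : 1 / 2 ≤ κ.re)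
    (hκ1 : κ.re < 1) :
    gramSum (q := q) W X Y κ = (1 / (2 * π) : ℂ) * ∫ y : ℝ, gramIntegrand (q := q) W X Y κ (1 + y * I) := by
  rw [gramSum, tsum_single_eq_integral hW hX (by linarith), tsum_single_eq_integral hW hY (by linarith),
    ← mul_sub, ← integral_sub (integrable_single_right hW hX hκ) (integrable_single_right hW hY hκ)]
  congr 1
  refine integral_congr_ae (Filter.Eventually.of_forall fun y => ?_)
  have hne : (1 : ℂ) + y * I ≠ 1 - κ := by
    intro h; have := congrArg Complex.re h; simp at this; linarith
  simp only
  rw [gramIntegrand_eq_LFunction W X Y κ hne]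
  ring

/-! ### The shift and the main formula -/

/-- The pole `w₁ = 1 − κ`. [folklore] -/
theorem re_one_sub (κ : ℂ) : (1 - κ).re = 1 - κ.re := by simp

/-- **The Gram sum formula**: for `1 ≤ Y ≤ X`, `1 < W`, `1/2 ≤ re κ < 1`:
`G(κ) = E_q(1) D_q(1) (X^{w₁} − Y^{w₁}) Γ(w₁) + (1/2π) ∫ H(−1/4 + iy) dy`, `w₁ = 1 − κ`.
[cite: HeathBrown1992PLMS, §11 (11.16)–(11.17)] -/
theorem gramSum_eq [NeZero q] (hX : 0 < X) (hY : 0 < Y) (hW : 1 < W) (hY1 : 1 ≤ Y) (hYX : Y ≤ X) {κ : ℂ} (hκ : 1 / 2 ≤ κ.re)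
    (hκ1 : κ.re < 1) :
    gramSum (q := q) W X Y κ =
      eulerQ q 1 * Fpoly (1 : DirichletCharacter ℂ q) 1 W W 1 *
        (((X : ℂ) ^ (1 - κ) - (Y : ℂ) ^ (1 - κ)) * Complex.Gamma (1 - κ)) +
      (1 / (2 * π) : ℂ) * ∫ y : ℝ, gramIntegrand (q := q) W X Y κ ((-1 / 4 : ℝ) + y * I) := by
  set w₁ : ℂ := 1 - κ with hw₁
  have hw₁re : w₁.re = 1 - κ.re := re_one_sub κ
  have hw₁0 : w₁ ≠ 0 := by
    intro h; have := congrArg Complex.re h; rw [hw₁re, Complex.zero_re] at this; linarith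
  set Res : ℂ := eulerQ q 1 * Fpoly (1 : DirichletCharacter ℂ q) 1 W W 1 *
    (((X : ℂ) ^ w₁ - (Y : ℂ) ^ w₁) * Complex.Gamma w₁) with hRes
  set r : ℂ → ℂ := fun p => if p = 0 then 0 else Res with hr
  have hopenU : IsOpen {w : ℂ | -1 < w.re} := isOpen_lt continuous_const Complex.continuous_re
  have h := Literature.Analysis.Complex.integral_vertical_sub_eq_sum_of_simplePoles
    (F := gramIntegrand (q := q) W X Y κ) (a := -1 / 4) (b := 1) (by norm_num) ({0, w₁} : Finset ℂ)
    r {w : ℂ | -1 < w.re} hopenU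
    (fun w hw => by
      simp only [Set.mem_preimage, Set.mem_Icc] at hw
      show -1 < w.re; linarith [hw.1])
    (fun p hp => by
      simp only [Finset.mem_insert, Finset.mem_singleton] at hp
      rcases hp with rfl | rfl
      · simp only [Complex.zero_re, Set.mem_Ioo]; norm_num
      · rw [Set.mem_Ioo, hw₁re]; constructor <;> linarith)
    (by
      rw [Finset.coe_insert, Finset.coe_singleton]
      exact differentiableOn_gramIntegrand hX hY W κ)
    (fun p hp => by
      simp only [Finset.mem_insert, Finset.mem_singleton] at hp
      rcases hp with rfl | rfl
      · -- the removable singularity at `0`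
        refine ⟨gramNumer₀ (q := q) W X Y κ, {w : ℂ | -1 < w.re} \ {w₁},
          (hopenU.sdiff isClosed_singleton).mem_nhds ⟨by simp, by simpa using hw₁0.symm⟩,
          differentiableOn_gramNumer₀ hX hY W κ, ?_, fun z _ hz => gramIntegrand_eq_div₀ W X Y κ hz⟩
        rw [hr]; simp [gramNumer₀_zero]
      · -- the pole at `w₁`
        refine ⟨gramNumer₁ (q := q) W X Y κ, {w : ℂ | 0 < w.re},
          (isOpen_lt continuous_const Complex.continuous_re).mem_nhds (by
            show 0 < w₁.re; rw [hw₁re]; linarith),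
          differentiableOn_gramNumer₁ hX hY W κ, ?_, fun z _ _ => gramIntegrand_eq_div₁ W X Y κ z⟩
        rw [hr]; simp only [hw₁0, if_false, hRes, gramNumer₁]
        rw [show κ + w₁ = 1 by rw [hw₁]; ring, riemannZeta₁_one, mul_one]; ring)
    (integrable_gramIntegrand_left hX hY hW hYX hκ hκ1.le)
    (by simpa using integrable_gramIntegrand_right hX hY hW hY1 hYX hκ)
    (decay_gramIntegrand hX hY hW hY1 hYX hκ)
  have hsum : ∑ p ∈ ({0, w₁} : Finset ℂ), r p = Res := by
    rw [Finset.sum_pair hw₁0.symm, hr]; simp [hw₁0]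
  rw [hsum, Complex.ofReal_one] at h
  rw [gramSum_eq_integral hX hY hW hκ hκ1]
  have hπ : (2 * π : ℂ) ≠ 0 := by exact_mod_cast (by positivity : (2 * π : ℝ) ≠ 0)
  have : ∫ y : ℝ, gramIntegrand (q := q) W X Y κ (1 + y * I) =
      (∫ y : ℝ, gramIntegrand (q := q) W X Y κ ((-1 / 4 : ℝ) + y * I)) + 2 * π * Res := by
    linear_combination h
  rw [this, mul_add]
  have h2 : (1 / (2 * π) : ℂ) * (2 * π * Res) = Res := by field_simp
  rw [h2, add_comm]

/-! ### The bound for the Gram entries -/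

/-- **The Gram entry bound**: for `1 ≤ Y ≤ X`, `1 < W`, `1/2 ≤ re κ < 1`:
`‖G(κ)‖ ≤ (φ(q)/q) ‖D_q(1)‖ ‖(X^{w₁} − Y^{w₁}) Γ(w₁)‖ + 512 K₂`,
`K₂ = (4096π²/3) 2^{ω(q)} (1 + ‖κ‖) ⌊W⌋² Y^{-1/4}`. [cite: HeathBrown1992PLMS, §11 (11.16)–(11.17)] -/
theorem norm_gramSum_le [NeZero q] (hq : q ≠ 0) (hX : 0 < X) (hY : 0 < Y) (hW : 1 < W) (hY1 : 1 ≤ Y) (hYX : Y ≤ X) {κ : ℂ}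
    (hκ : 1 / 2 ≤ κ.re) (hκ1 : κ.re < 1) :
    ‖gramSum (q := q) W X Y κ‖ ≤
      (q.totient : ℝ) / q * ‖Fpoly (1 : DirichletCharacter ℂ q) 1 W W 1‖ *
        ‖((X : ℂ) ^ (1 - κ) - (Y : ℂ) ^ (1 - κ)) * Complex.Gamma (1 - κ)‖ +
      512 * (4096 * π ^ 2 / 3 * 2 ^ q.primeFactors.card * (1 + ‖κ‖) * ((⌊W⌋₊ : ℝ) * ⌊W⌋₊) *
        Y ^ (-(1 / 4 : ℝ))) := by
  rw [gramSum_eq hX hY hW hY1 hYX hκ hκ1]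
  refine (norm_add_le _ _).trans (add_le_add ?_ ?_)
  · rw [norm_mul, norm_mul, eulerQ_one hq, Complex.norm_real, Real.norm_of_nonneg (by positivity)]
  · set K : ℝ := 4096 * π ^ 2 / 3 * 2 ^ q.primeFactors.card * (1 + ‖κ‖) * ((⌊W⌋₊ : ℝ) * ⌊W⌋₊) *
      Y ^ (-(1 / 4 : ℝ)) with hK
    have hK0 : 0 ≤ K := by rw [hK]; positivity
    have hbound : ∀ y : ℝ, ‖gramIntegrand (q := q) W X Y κ ((-1 / 4 : ℝ) + y * I)‖ ≤ K * 1024 * (1 + y ^ 2)⁻¹ := by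
      intro y
      calc ‖gramIntegrand (q := q) W X Y κ ((-1 / 4 : ℝ) + y * I)‖
          ≤ K * ((1 + |y|) ^ (5 / 2 : ℝ) * Real.exp (-(π * |y|) / 2)) :=
            norm_gramIntegrand_left_le hX hY hW hYX hκ hκ1.le y
        _ ≤ K * (1024 * (1 + y ^ 2)⁻¹) := mul_le_mul_of_nonneg_left (rpow_mul_exp_le_inv_one_add_sq y) hK0
        _ = K * 1024 * (1 + y ^ 2)⁻¹ := by ring
    have hint : ‖∫ y : ℝ, gramIntegrand (q := q) W X Y κ ((-1 / 4 : ℝ) + y * I)‖ ≤ K * 1024 * π := by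
      calc ‖∫ y : ℝ, gramIntegrand (q := q) W X Y κ ((-1 / 4 : ℝ) + y * I)‖
          ≤ ∫ y : ℝ, K * 1024 * (1 + y ^ 2)⁻¹ :=
            norm_integral_le_of_norm_le ((integrable_inv_one_add_sq).const_mul _)
              (Filter.Eventually.of_forall hbound)
        _ = K * 1024 * π := by rw [MeasureTheory.integral_const_mul, integral_univ_inv_one_add_sq]
    have hc : ‖(1 / (2 * π) : ℂ)‖ = 1 / (2 * π) := by
      rw [show (1 / (2 * π) : ℂ) = ((1 / (2 * π) : ℝ) : ℂ) by push_cast; ring, Complex.norm_real,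
        Real.norm_of_nonneg (by positivity)]
    rw [norm_mul, hc]
    calc 1 / (2 * π) * ‖∫ y : ℝ, gramIntegrand (q := q) W X Y κ ((-1 / 4 : ℝ) + y * I)‖
        ≤ 1 / (2 * π) * (K * 1024 * π) := mul_le_mul_of_nonneg_left hint (by positivity)
      _ = 512 * K := by field_simp; ring


/-! ### The Gamma factor -/

/-- `‖X^w − Y^w‖ ≤ ‖w‖ log(X/Y) X^{re w}` for `1 ≤ Y ≤ X`, `re w ≥ 0`
(`X^w − Y^w = ∫_{log Y}^{log X} w e^{wu} du`). [folklore] -/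
theorem norm_cpow_sub_cpow_le_log {X Y : ℝ} (hY1 : 1 ≤ Y) (hYX : Y ≤ X) {w : ℂ} (hw : 0 ≤ w.re) :
    ‖(X : ℂ) ^ w - (Y : ℂ) ^ w‖ ≤ ‖w‖ * Real.log (X / Y) * X ^ w.re := by
  have hY0 : 0 < Y := by linarith
  have hX0 : 0 < X := by linarith
  have hlog : Real.log Y ≤ Real.log X := Real.log_le_log hY0 hYX
  -- `X^w = exp(w log X)`
  have hcpow : ∀ {Z : ℝ}, 0 < Z → (Z : ℂ) ^ w = Complex.exp (w * Real.log Z) := by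
    intro Z hZ
    rw [Complex.cpow_def_of_ne_zero (by exact_mod_cast hZ.ne'), ← Complex.ofReal_log hZ.le, mul_comm]
  have hderiv : ∀ u ∈ Set.uIcc (Real.log Y) (Real.log X),
      HasDerivAt (fun u : ℝ => Complex.exp (w * u)) (w * Complex.exp (w * u)) u := by
    intro u _
    have hc : HasDerivAt (fun z : ℂ => Complex.exp (w * z)) (Complex.exp (w * u) * (w * 1)) (u : ℂ) :=
      ((hasDerivAt_id (u : ℂ)).const_mul w).cexp
    have := hc.comp_ofReal
    rw [mul_one, mul_comm] at this
    exact this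
  have hcont : Continuous fun u : ℝ => w * Complex.exp (w * u) := by fun_prop
  have hftc := intervalIntegral.integral_eq_sub_of_hasDerivAt hderiv (hcont.intervalIntegrable _ _)
  have heq : (X : ℂ) ^ w - (Y : ℂ) ^ w = ∫ u in Real.log Y..Real.log X, w * Complex.exp (w * u) := by
    rw [hftc, hcpow hX0, hcpow hY0]
  rw [heq]
  have hbd : ∀ u ∈ Set.Ioc (Real.log Y) (Real.log X), ‖w * Complex.exp (w * u)‖ ≤ ‖w‖ * X ^ w.re := by
    intro u hu
    rw [norm_mul, Complex.norm_exp]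
    refine mul_le_mul_of_nonneg_left ?_ (norm_nonneg _)
    have : (w * (u : ℂ)).re = w.re * u := by simp
    rw [this, Real.rpow_def_of_pos hX0, mul_comm (Real.log X)]
    exact Real.exp_le_exp.2 (mul_le_mul_of_nonneg_left hu.2 hw)
  calc ‖∫ u in Real.log Y..Real.log X, w * Complex.exp (w * u)‖
      ≤ ‖w‖ * X ^ w.re * |Real.log X - Real.log Y| :=
        intervalIntegral.norm_integral_le_of_norm_le_const (by
          intro u hu
          rw [Set.uIoc_of_le hlog] at hu
          exact hbd u hu)
    _ = ‖w‖ * Real.log (X / Y) * X ^ w.re := by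
        rw [abs_of_nonneg (by linarith), Real.log_div hX0.ne' hY0.ne']; ring

/-- **The Gamma factor, near the diagonal**: for `1 ≤ Y ≤ X` and `0 < re w ≤ 1`,
`‖(X^w − Y^w) Γ(w)‖ ≤ 16π² (1+|im w|)^{3/2} e^{-π|im w|/2} · log(X/Y) · X^{re w}`.
[cite: HeathBrown1992PLMS, §11 (11.17)] -/
theorem norm_cpow_sub_cpow_mul_Gamma_le_log {X Y : ℝ} (hY1 : 1 ≤ Y) (hYX : Y ≤ X) {w : ℂ}
    (hw : 0 < w.re) (hw1 : w.re ≤ 1) :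
    ‖((X : ℂ) ^ w - (Y : ℂ) ^ w) * Complex.Gamma w‖ ≤
      16 * π ^ 2 * (1 + |w.im|) ^ (3 / 2 : ℝ) * Real.exp (-(π * |w.im|) / 2) *
        Real.log (X / Y) * X ^ w.re := by
  have hw0 : w ≠ 0 := by intro h; rw [h] at hw; simp at hw
  have hweq : w = (w.re : ℂ) + w.im * I := (Complex.re_add_im w).symm
  have hΓ : ‖Complex.Gamma w‖ ≤ 16 * π ^ 2 * (1 + |w.im|) ^ (3 / 2 : ℝ) * Real.exp (-(π * |w.im|) / 2) / ‖w‖ := by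
    have h := norm_Gamma_le_step (x := w.re) hw.le hw1 (y := w.im) (by rw [← hweq]; exact hw0)
    rw [← hweq] at h; exact h
  have h1 := norm_cpow_sub_cpow_le_log hY1 hYX hw.le
  have hnw : 0 < ‖w‖ := norm_pos_iff.2 hw0
  rw [norm_mul]
  calc ‖(X : ℂ) ^ w - (Y : ℂ) ^ w‖ * ‖Complex.Gamma w‖
      ≤ (‖w‖ * Real.log (X / Y) * X ^ w.re) *
        (16 * π ^ 2 * (1 + |w.im|) ^ (3 / 2 : ℝ) * Real.exp (-(π * |w.im|) / 2) / ‖w‖) :=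
        mul_le_mul h1 hΓ (norm_nonneg _) (by
          have : 0 ≤ Real.log (X / Y) := Real.log_nonneg ((one_le_div (by linarith)).2 hYX)
          have : (0 : ℝ) ≤ X := by linarith
          positivity)
    _ = _ := by field_simp

/-- **The Gamma factor, off the diagonal**: for `1 ≤ Y ≤ X` and `0 < re w ≤ 1`,
`‖(X^w − Y^w) Γ(w)‖ ≤ 16π² (1+|im w|)^{3/2} e^{-π|im w|/2} · 2 X^{re w} / ‖w‖`.
[cite: HeathBrown1992PLMS, §11 (11.17)] -/
theorem norm_cpow_sub_cpow_mul_Gamma_le_inv {X Y : ℝ} (hY1 : 1 ≤ Y) (hYX : Y ≤ X) {w : ℂ}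
    (hw : 0 < w.re) (hw1 : w.re ≤ 1) :
    ‖((X : ℂ) ^ w - (Y : ℂ) ^ w) * Complex.Gamma w‖ ≤
      16 * π ^ 2 * (1 + |w.im|) ^ (3 / 2 : ℝ) * Real.exp (-(π * |w.im|) / 2) *
        (2 * X ^ w.re) / ‖w‖ := by
  have hw0 : w ≠ 0 := by intro h; rw [h] at hw; simp at hw
  have hweq : w = (w.re : ℂ) + w.im * I := (Complex.re_add_im w).symm
  have hΓ : ‖Complex.Gamma w‖ ≤ 16 * π ^ 2 * (1 + |w.im|) ^ (3 / 2 : ℝ) * Real.exp (-(π * |w.im|) / 2) / ‖w‖ := by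
    have h := norm_Gamma_le_step (x := w.re) hw.le hw1 (y := w.im) (by rw [← hweq]; exact hw0)
    rw [← hweq] at h; exact h
  have hY0 : 0 < Y := by linarith
  have hX0 : 0 < X := by linarith
  have h1 : ‖(X : ℂ) ^ w - (Y : ℂ) ^ w‖ ≤ 2 * X ^ w.re := by
    refine (norm_cpow_sub_cpow_le hX0 hY0 w).trans ?_
    have : Y ^ w.re ≤ X ^ w.re := Real.rpow_le_rpow hY0.le hYX hw.le
    linarith
  rw [norm_mul]
  calc ‖(X : ℂ) ^ w - (Y : ℂ) ^ w‖ * ‖Complex.Gamma w‖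
      ≤ (2 * X ^ w.re) * (16 * π ^ 2 * (1 + |w.im|) ^ (3 / 2 : ℝ) * Real.exp (-(π * |w.im|) / 2) / ‖w‖) :=
        mul_le_mul h1 hΓ (norm_nonneg _) (by positivity)
    _ = _ := by ring

end Literature.NumberTheory.LFunctions.LFDSingle
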